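import Mathlib
import Literature.NumberTheory.Transcendental.KirbyWeakSchanuelAx
import Literature.NumberTheory.Transcendental.RoyCriterion
import HarnessLib

/-!
# Barrier (Schanuel): at a FIRST FAILURE of Schanuel's conjecture every family of derivations of `ℂ` that is exponential on the tuple — E-derivation or not — kills every coordinate

`Literature/Barriers/Schanuel/AxLocalDerivationsBlind.lean` — barrier catalogue entry (D-0021)
for the summit `Schanuel` (`Summits/Schanuel/Schanuel/Statement.lean`; the summit is
`Literature.ModelTheory.ExponentialFields.SchanuelProperty ℂ`, i.e. `∀ n, SchanuelRank n`, by
`Iff.rfl`), sharpening entry B7 `Literature.Barriers.Schanuel.AxSchanuelFunctionalNotNumerical`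
(`AxSchanuelFunctionalNotNumerical.lean`). B7 (iii) proves that every E-DERIVATION of `ℂ_exp`
vanishes on `ecl ∅`, so that the hypothesis of Ax's Theorem 3 ("`ℚ`-linearly independent modulo
the constants", tree `Literature.NumberTheory.Transcendental.IsQLinearIndependentMod`) fails for
families of E-derivations at exponentially algebraic tuples, and its `scope_caveats` (b) record
that "Ax's theorem as printed (and the tree's `ax_schanuel`) allows arbitrary derivations
satisfying `D zᵢ = zᵢ D yᵢ` on the tuple only, which is NOT excluded". This file closes that
escape wherever a proof of the summit BY CONTRADICTION would use it: at a FIRST FAILURE `x ∈ ℂⁿ`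
of Schanuel's conjecture (`x` `ℚ`-linearly independent, `trdeg_ℚ ℚ(x, eˣ) < n`, and
`SchanuelRank r` for all `r < n`; every failure of the conjecture produces one,
`exists_firstFailure_of_not_schanuelProperty`), EVERY finite family `D₁, …, D_m` of derivations of
`ℂ` with `Dⱼ(e^{xᵢ}) = e^{xᵢ} Dⱼ(xᵢ)` on the tuple satisfies `Dⱼ(xᵢ) = 0` for all `i, j`
(`axLocalDerivationsBlind_holds`); hence Ax's hypothesis fails (`not_isQLinearIndependentMod_of_firstFailure`)
and Ax's rank term vanishes. Everything here is PROVED (sorry-free, axioms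
`propext/Classical.choice/Quot.sound`), on top of the tree's PROOF of Ax's theorem
(`Literature.NumberTheory.Transcendental.ax_schanuel_holds`, via Rosenlicht) and of Kirby's
Khovanskii dichotomy (`Literature.NumberTheory.Transcendental.khovanskii_dichotomy`, Lemma 4.8).

## The argument (Kirby 2010, Prop. 4.7 and Prop. 7.2, read pointwise at a first failure)

1. `firstFailure_exists_khovanskiiSystem` — **a first failure is a non-degenerate KHOVANSKII POINT
   of its own `ℚ`-locus**: there are `g₁, …, gₙ ∈ ℚ[X̄, Ȳ]` with `gᵢ(x, eˣ) = 0` and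
   `det((∂/∂Xⱼ + Yⱼ ∂/∂Yⱼ) gᵢ)(x, eˣ) ≠ 0`. Proof (this is the Summits-side support theorem
   `Summit.Schanuel.Schanuel.Theorems.MinimalCounterexampleInAcl.Negative.firstFailure_khovanskii`
   of `KhovanskiiPoint.lean`, re-proved here VERBATIM because `Literature/` may not import
   `Summits/`; all its ingredients are Literature theorems): the Khovanskii dichotomy inside
   `L = ℚ(x, eˣ)`; the alternative is a non-zero derivation `D` of `L` over `ℚ` with
   `D(e^{xᵢ}) = e^{xᵢ} D(xᵢ)`, and then Ax's Theorem 3 WITH its rank term for a maximal sub-tuple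
   independent modulo the constants of `D` (`n' + 1 ≤ trdeg`), `SchanuelRank m` for the integral
   combinations `q·x` lying in the constants (`m ≤ trdeg`), and the tower law
   (`trdeg_add_le_of_le_subring`) give `n + 1 = m + n' + 1 ≤ trdeg ℚ(x, eˣ) < n`. (Kirby's
   Prop. 7.2 "essential counterexamples are exponentially algebraic", pointwise.)
2. `derivation_apply_eq_zero_of_khovanskiiSystem` — **the Jacobian argument of Kirby's Prop. 4.7
   for ARBITRARY derivations exponential on the tuple only**: a derivation of a field `K ⊇ ℚ`
   kills `ℚ`, so the chain rule (`derivation_mvPolynomial_aeval`) and the local rule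
   `D(yᵢ) = yᵢ D(xᵢ)` give `D(g(x, y)) = ∑ⱼ ((∂/∂Xⱼ + Yⱼ ∂/∂Yⱼ) g)(x, y) · D(xⱼ)`
   (`sum_aeval_pderiv_mul_eq`); at a non-degenerate solution `J · (D xⱼ)ⱼ = 0` forces `D xⱼ = 0`
   (`Matrix.eq_zero_of_mulVec_eq_zero`). No E-derivation hypothesis is used — only the `n`
   relations `D(e^{xᵢ}) = e^{xᵢ} D(xᵢ)`, exactly the hypothesis of Ax's Theorem 3 / of the tree's
   `ax_schanuel`.
3. `axLocalDerivationsBlind_holds` = 1 + 2; corollaries `firstFailure_mem_constantSubring`,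
   `not_isQLinearIndependentMod_of_firstFailure`, `firstFailure_rank_eq_zero`, and — with
   `exists_firstFailure_of_not_schanuelProperty` — `not_schanuelProperty_imp_ax_hypothesis_fails`:
   if Schanuel's conjecture fails, it fails at a tuple at which Ax's Theorem 3 has NO instance,
   whatever the family of derivations exponential on the tuple.

## What the sources print (verified on the page, arXiv:0810.4285)

* Kirby 2010 [Kirby2010], Prop. 4.7: "Let `R` be a partial E-domain and `C` a subset of `R`.
  Then `ecl^R(C) ⊆ cl^R(C)`." Proof: "Suppose `∂ ∈ Der(R/C)`, and let `J` be the Jacobian matrix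
  … Then by lemma [4.6], `J (∂a₁, …, ∂aₙ)ᵀ = 0`. Since `ā` solves the Khovanskii system, the
  determinant `|J| ≠ 0` … hence `∂aᵢ = 0` for each `i`."
* ibid. Lemma 4.8: "`Ξ(F/C)` is the `F`-vector space generated by `da₁, …, daₙ` subject to the
  relations `∑ᵢ (∂f/∂Xᵢ)(ā) daᵢ = 0` for each `f ∈ C[X̄]^E` such that `f(ā) = 0`."
* ibid. Thm. 5.1 (= Ax 1971, Thm. 3 [Ax1971]): "Let `F` be a field of characteristic 0, let `Δ`
  be a set of derivations on `F`, and let `C = ⋂_{∂ ∈ Δ} ker ∂` be the field of constants.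
  Suppose `x₁, …, xₙ, y₁, …, yₙ ∈ F` satisfy `∂yᵢ = yᵢ∂xᵢ` for each `i = 1, …, n` and each
  `∂ ∈ Δ`. Then `td(x̄, ȳ/C) ≥ ldim_ℚ(x̄/C) + rk(∂xᵢ)_{∂ ∈ Δ, i = 1, …, n}`."
* ibid. Prop. 7.2: "In any partial E-field `F`, if `ā` is an essential counterexample to the
  Schanuel property then `ā` is contained in `ecl^F(∅)`."; §1 (after Thm. 1.4): "every
  counterexample contains an essential counterexample in its `ℚ`-linear span".
* Bays–Kirby–Wilkie 2010 [BaysKirbyWilkie2010], Thm. 1.2 (the surviving numerical output of Ax's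
  theorem, at exponentially TRANSCENDENTAL parameters): tree fact
  `Literature.Barriers.Schanuel.baysKirbyWilkie2010_thm_1_2` (B7).

## Lean rendering (all vocabulary is the tree's)

`SchanuelRank` (`RoyCriterion.lean`), `constantSubring`, `IsQLinearIndependentMod`, `ax_schanuel`
(`AxSchanuel.lean`, PROVED `ax_schanuel_holds`), `Khovanskii.ePD` (`EclPregeometryProofs.lean`),
`khovanskii_dichotomy`, `sum_aeval_pderiv_mul_eq` (`KhovanskiiDichotomy.lean`),
`derivation_mvPolynomial_aeval` (`KirbyEDerivations.lean`), `trdeg_add_le_of_le_subring`,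
`derivation_prod_zpow_of_exp`, `exists_nat_mul_eq_intCast` (`KirbyWeakSchanuelAx.lean`).
Derivations are `Derivation ℤ ℂ ℂ` (plain derivations of the ring `ℂ`), as in `ax_schanuel`. One
new named declaration of kind `Prop` (`AxLocalDerivationsBlind`, PROVED); no named fact.

## References

* [Ax1971] J. Ax, *On Schanuel's conjectures*, Ann. of Math. 93 (1971) 252–268, Thm. 3.
* [Kirby2010] J. Kirby, *Exponential algebraicity in exponential fields*, Bull. Lond. Math.
  Soc. 42 (2010) 879–890 (arXiv:0810.4285): Lemma 4.6, Prop. 4.7, Lemma 4.8, Thm. 5.1, Prop. 7.2,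
  §1.
* [BaysKirbyWilkie2010] M. Bays, J. Kirby, A. J. Wilkie, *A Schanuel property for exponentially
  transcendental powers*, Bull. Lond. Math. Soc. 42 (2010) 917–922, Thm. 1.2.
* [Pila2022] J. Pila, *Point-counting and the Zilber–Pink conjecture*, CUP 2022, Ch. 13, p. 96
  (generic powers from Ax–Schanuel; cited as in B7).
-/

noncomputable section

open Complex Set MvPolynomial
open Literature.NumberTheory.Transcendental

namespace Literature.Barriers.Schanuel

/-! ### 1. The Jacobian argument for arbitrary derivations exponential on the tuple -/

section Jacobian

variable {K : Type*} [Field K] [CharZero K]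

/-- Chain rule for a plain derivation `D` of a field of characteristic zero and a polynomial with
RATIONAL coefficients: `D(f(z)) = ∑ₛ (∂f/∂Xₛ)(z) · D(zₛ)` (`D` kills `ℚ`, tree
`derivation_map_ratCast`, so it is a `ℚ`-derivation and the tree's `derivation_mvPolynomial_aeval`
applies). [cite: Kirby2010, Lemma 4.6] -/
theorem intDerivation_mvPolynomial_aeval {σ : Type*} [Fintype σ] (D : Derivation ℤ K K)
    (z : σ → K) (f : MvPolynomial σ ℚ) :
    D (aeval z f) = ∑ s, aeval z (pderiv s f) * D (z s) := by
  have hF : ∀ c : ℚ, D (algebraMap ℚ K c) = 0 := fun c => by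
    rw [eq_ratCast]
    exact derivation_map_ratCast D c
  -- the derivation as a `ℚ`-derivation
  let D' : Derivation ℚ K K :=
    { toFun := D
      map_add' := map_add D
      map_smul' := fun c a => derivation_map_smul_of_forall_algebraMap D hF c a
      map_one_eq_zero' := D.map_one_eq_zero
      leibniz' := fun a b => D.leibniz a b }
  have hD' : ∀ a, D' a = D a := fun _ => rfl
  rw [← hD', derivation_mvPolynomial_aeval D' z f]
  exact Finset.sum_congr rfl fun s _ => by rw [hD', smul_eq_mul]

/-- **Kirby's Prop. 4.7 Jacobian argument, for an ARBITRARY derivation exponential on the tuple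
only.** If `(x, y)` is a non-degenerate solution of `n` polynomial equations `gᵢ(x, y) = 0`,
`gᵢ ∈ ℚ[X̄, Ȳ]`, for the exponential Jacobian `det((∂/∂Xⱼ + Yⱼ ∂/∂Yⱼ) gᵢ)(x, y) ≠ 0` (a
Khovanskii system when `y = eˣ`), then every derivation `D` of `K` with `D(yᵢ) = yᵢ D(xᵢ)` for
all `i` kills every `xᵢ`: `J · (D xⱼ)ⱼ = 0` by the chain rule, and `det J ≠ 0`. The tree's
`ecl_subset_dcl` is the case of an E-derivation of an exponential field; here only the `n` local
relations are used. [cite: Kirby2010, Prop. 4.7] -/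
theorem derivation_apply_eq_zero_of_khovanskiiSystem {n : ℕ} (x y : Fin n → K)
    (g : Fin n → MvPolynomial (Fin n ⊕ Fin n) ℚ)
    (hg0 : ∀ i, aeval (Sum.elim x y) (g i) = 0)
    (hdet : (Matrix.of fun i j => aeval (Sum.elim x y) (Khovanskii.ePD j (g i))).det ≠ 0)
    (D : Derivation ℤ K K) (hD : ∀ i, D (y i) = y i * D (x i)) : ∀ i, D (x i) = 0 := by
  classical
  set J : Matrix (Fin n) (Fin n) K :=
    Matrix.of fun i j => aeval (Sum.elim x y) (Khovanskii.ePD j (g i)) with hJ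
  have hmul : J.mulVec (fun j => D (x j)) = 0 := by
    ext i
    have h := intDerivation_mvPolynomial_aeval D (Sum.elim x y) (g i)
    rw [hg0 i, map_zero] at h
    have h2 : ∑ s, aeval (Sum.elim x y) (pderiv s (g i)) * D (Sum.elim x y s) =
        ∑ s, aeval (Sum.elim x y) (pderiv s (g i)) *
          Sum.elim (fun j => D (x j)) (fun j => y j * D (x j)) s := by
      refine Finset.sum_congr rfl fun s _ => ?_
      rcases s with j | j
      · rfl
      · rw [Sum.elim_inr, Sum.elim_inr, hD j]
    rw [h2, sum_aeval_pderiv_mul_eq x y (fun j => D (x j)) (g i)] at h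
    rw [Pi.zero_apply, Matrix.mulVec, dotProduct, h]
    rfl
  have h0 := Matrix.eq_zero_of_mulVec_eq_zero hdet hmul
  exact fun i => congr_fun h0 i

end Jacobian

/-! ### 2. A first failure is a non-degenerate Khovanskii point of its own `ℚ`-locus -/

set_option maxHeartbeats 1600000 in
/-- **A first failure is a non-degenerate KHOVANSKII POINT of its own locus**: if `x ∈ ℂⁿ` is
`ℚ`-linearly independent with `trdeg_ℚ ℚ(x, eˣ) < n` while Schanuel's conjecture holds in all
ranks `r < n`, there are `n` `ℚ`-relations `g₁, …, gₙ` of `(x, eˣ)` whose exponential Jacobian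
`det((∂ⱼ + Yⱼ∂_{n+j}) gᵢ (x, eˣ))` does not vanish. (Khovanskii dichotomy, tree
`khovanskii_dichotomy`: otherwise `ℚ(x, eˣ)` carries a non-zero derivation `D` over `ℚ` with
`D(e^{xᵢ}) = e^{xᵢ} D(xᵢ)`; Ax 1971 Thm 3 for it (tree `ax_schanuel_holds`), WITH its rank term,
plus `SchanuelRank m` on the constants `q·x`, and the tower law give `n + 1 ≤ trdeg ℚ(x, eˣ) < n`.)
This is the Summits-side `firstFailure_khovanskii` (`KhovanskiiPoint.lean`), re-proved verbatim in
`Literature/`. [cite: Kirby2010, Lemma 4.8 and Prop. 7.2] [cite: Ax1971, Thm. 3] -/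
theorem firstFailure_exists_khovanskiiSystem {n : ℕ} {x : Fin n → ℂ} (hxli : LinearIndependent ℚ x)
    (htr : Algebra.trdeg ℚ ↥(IntermediateField.adjoin ℚ (range x ∪ range (cexp ∘ x))) < (n : Cardinal))
    (hrank : ∀ r < n, SchanuelRank r) :
    ∃ g : Fin n → MvPolynomial (Fin n ⊕ Fin n) ℚ,
      (∀ i, MvPolynomial.aeval (Sum.elim x (cexp ∘ x)) (g i) = 0) ∧
      (Matrix.of fun i j => MvPolynomial.aeval (Sum.elim x (cexp ∘ x))
        (Khovanskii.ePD j (g i))).det ≠ 0 := by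
  classical
  rcases Nat.eq_zero_or_pos n with rfl | hn
  · exact absurd htr (not_lt.2 (by simp))
  -- the field `L = ℚ(x̄, e^{x̄})`
  set S : Set ℂ := Set.range x ∪ Set.range (cexp ∘ x) with hS
  set L : IntermediateField ℚ ℂ := IntermediateField.adjoin ℚ S with hL
  have hxS : ∀ i, x i ∈ L := fun i => IntermediateField.subset_adjoin ℚ S (Or.inl ⟨i, rfl⟩)
  have hyS : ∀ i, cexp (x i) ∈ L := fun i => IntermediateField.subset_adjoin ℚ S (Or.inr ⟨i, rfl⟩)
  set xL : Fin n → L := fun i => ⟨x i, hxS i⟩ with hxL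
  set yL : Fin n → L := fun i => ⟨cexp (x i), hyS i⟩ with hyL
  have hy0 : ∀ i, yL i ≠ 0 := fun i h => Complex.exp_ne_zero (x i) (congrArg Subtype.val h)
  have htopL : IntermediateField.adjoin ℚ (Set.range xL ∪ Set.range yL) = ⊤ := by
    have h := IntermediateField.adjoin_preimage_val_eq_top (F := ℚ) S
    have hpre : Set.range xL ∪ Set.range yL = ((↑) : L → ℂ) ⁻¹' S := by
      ext t
      simp only [Set.mem_union, Set.mem_range, Set.mem_preimage, hS, Function.comp_apply]
      constructor
      · rintro (⟨i, rfl⟩ | ⟨i, rfl⟩)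
        · exact Or.inl ⟨i, rfl⟩
        · exact Or.inr ⟨i, rfl⟩
      · rintro (⟨i, hi⟩ | ⟨i, hi⟩)
        · exact Or.inl ⟨i, Subtype.ext hi⟩
        · exact Or.inr ⟨i, Subtype.ext hi⟩
    rw [hpre]
    exact h
  set zL : Fin n ⊕ Fin n → L := Sum.elim xL yL with hzL
  have hpt : Sum.elim x (cexp ∘ x) = algebraMap L ℂ ∘ zL := by
    funext s; rcases s with i | i <;> rfl
  have heval : ∀ p : MvPolynomial (Fin n ⊕ Fin n) ℚ,
      MvPolynomial.aeval (Sum.elim x (cexp ∘ x)) p = algebraMap L ℂ (MvPolynomial.aeval zL p) := by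
    intro p
    rw [hpt, MvPolynomial.aeval_algebraMap_apply]
  rcases khovanskii_dichotomy xL yL htopL with ⟨g, hg0, hdet⟩ | ⟨D, hDE, j₀, hj₀⟩
  · /- (a) a Khovanskii system over ℚ: transport to ℂ -/
    simp only [← hzL] at hg0 hdet
    refine ⟨g, fun i => ?_, ?_⟩
    · rw [heval, hg0 i, map_zero]
    · have hJ : (Matrix.of fun i j => MvPolynomial.aeval (Sum.elim x (cexp ∘ x))
          (Khovanskii.ePD j (g i))) =
          (algebraMap L ℂ).mapMatrix (Matrix.of fun i j => MvPolynomial.aeval zL (Khovanskii.ePD j (g i))) := by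
        ext i j
        simp only [Matrix.of_apply, RingHom.mapMatrix_apply, Matrix.map_apply]
        rw [heval]
      rw [hJ, ← RingHom.map_det, map_ne_zero]
      exact hdet
  · /- (b) a non-zero E-derivation `D` of `L` over `ℚ`: impossible at a first failure -/
    exfalso
    set Dz : Derivation ℤ L L := D.restrictScalars ℤ with hDz
    set D1 : Fin 1 → Derivation ℤ L L := fun _ => Dz with hD1
    set CD : Subring L := constantSubring D1 with hCD
    have hmemCD : ∀ a : L, a ∈ CD ↔ D a = 0 := fun a => by
      simp only [hCD, hD1, hDz, mem_constantSubring, forall_const]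
      exact Iff.rfl
    have hFCD : ∀ c : ℚ, algebraMap ℚ L c ∈ CD := fun c => (hmemCD _).mpr (D.map_algebraMap c)
    -- the elements of `L` killed by `D`, as a `ℚ`-subspace `N` of `ℂ`
    set N : Submodule ℚ ℂ :=
      (LinearMap.ker (D : L →ₗ[ℚ] L)).map (IsScalarTower.toAlgHom ℚ L ℂ).toLinearMap with hN
    have hmemN : ∀ a : ℂ, a ∈ N ↔ ∃ l : L, D l = 0 ∧ (l : ℂ) = a := fun a => by
      simp only [hN, Submodule.mem_map, LinearMap.mem_ker]
      constructor
      · rintro ⟨l, hl, rfl⟩; exact ⟨l, hl, rfl⟩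
      · rintro ⟨l, hl, rfl⟩; exact ⟨l, hl, rfl⟩
    -- the dependence space `V = {q ∈ ℚⁿ | q·x̄ ∈ N}` and the splitting `n = n' + m`
    set T : (Fin n → ℚ) →ₗ[ℚ] ℂ := Fintype.linearCombination ℚ x with hT
    have hTapply : ∀ v : Fin n → ℚ, T v = ∑ i, v i • x i := fun v =>
      Fintype.linearCombination_apply ℚ x v
    set V : Submodule ℚ (Fin n → ℚ) := N.comap T with hV
    set T' : (Fin n → ℚ) →ₗ[ℚ] ℂ ⧸ N := N.mkQ ∘ₗ T with hT'
    have hker : LinearMap.ker T' = V := by rw [hT', LinearMap.ker_comp, Submodule.ker_mkQ]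
    obtain ⟨κ, a, ha, hspan, hli⟩ := exists_linearIndependent' ℚ ((Submodule.mkQ N) ∘ x)
    haveI : Fintype κ := Fintype.ofInjective a ha
    set n' := Fintype.card κ with hn'
    set e := Fintype.equivFin κ with he
    have hrange : Module.finrank ℚ (LinearMap.range T') = n' := by
      have h1 : LinearMap.range T' = Submodule.span ℚ (Set.range (N.mkQ ∘ x)) := by
        rw [hT', LinearMap.range_comp, hT, Fintype.range_linearCombination, Submodule.map_span,
          ← Set.range_comp]
      rw [h1, ← hspan, finrank_span_eq_card hli]
    set m := Module.finrank ℚ V with hm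
    have hnm : n' + m = n := by
      have := LinearMap.finrank_range_add_finrank_ker T'
      rwa [hrange, hker, Module.finrank_fin_fun] at this
    -- `x j₀ ∉ N`
    have hxj₀N : x j₀ ∉ N := by
      intro hmem
      obtain ⟨l, hl0, hl⟩ := (hmemN _).mp hmem
      have hlx : l = xL j₀ := Subtype.ext hl
      rw [hlx] at hl0
      exact hj₀ hl0
    have hmn : m < n := by
      by_contra hmn'
      have hmn2 : m = n := le_antisymm (by omega) (not_lt.mp hmn')
      have hVtop : V = ⊤ :=
        Submodule.eq_top_of_finrank_eq (by rw [← hm, hmn2, Module.finrank_fin_fun])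
      have hmemV : (Pi.single j₀ (1 : ℚ) : Fin n → ℚ) ∈ V := hVtop ▸ Submodule.mem_top
      rw [hV, Submodule.mem_comap, hT, Fintype.linearCombination_apply_single, one_smul] at hmemV
      exact hxj₀N hmemV
    -- every element of the sub-tuple has `D ≠ 0`, and the sub-tuple is non-empty
    have hDx' : ∀ k : κ, D (xL (a k)) ≠ 0 := by
      intro k hk
      have hmemN' : x (a k) ∈ N := (hmemN _).mpr ⟨xL (a k), hk, rfl⟩
      have h0 : ((Submodule.mkQ N) ∘ x ∘ a) k = 0 := by
        simp only [Function.comp_apply, Submodule.mkQ_apply, Submodule.Quotient.mk_eq_zero]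
        exact hmemN'
      exact hli.ne_zero k h0
    have hn'pos : 0 < n' := by
      rw [hn', Fintype.card_pos_iff]
      by_contra hempty
      rw [not_nonempty_iff] at hempty
      have hbot : Submodule.span ℚ (Set.range (((Submodule.mkQ N) ∘ x) ∘ a)) = ⊥ := by
        rw [Set.range_eq_empty, Submodule.span_empty]
      have hmem : (Submodule.mkQ N) (x j₀) ∈ Submodule.span ℚ (Set.range ((Submodule.mkQ N) ∘ x)) :=
        Submodule.subset_span ⟨j₀, rfl⟩
      rw [← hspan, hbot, Submodule.mem_bot, Submodule.mkQ_apply, Submodule.Quotient.mk_eq_zero] at hmem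
      exact hxj₀N hmem
    -- Ax's theorem, WITH the rank term, for the sub-tuple
    set x' : Fin n' → L := fun i => xL (a (e.symm i)) with hx'
    set y' : Fin n' → L := fun i => yL (a (e.symm i)) with hy'
    have hind : IsQLinearIndependentMod D1 x' := by
      intro q hq
      have hD0 : D (∑ i, (q i : L) * x' i) = 0 := (hmemCD _).mp hq
      have hNmem : (∑ i, ((q i : ℚ)) • x (a (e.symm i))) ∈ N := by
        refine (hmemN _).mpr ⟨_, hD0, ?_⟩
        rw [show (∑ i, ((q i : ℚ)) • x (a (e.symm i))) = ∑ i, (q i : ℂ) * x (a (e.symm i)) from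
          Finset.sum_congr rfl fun i _ => by rw [Rat.smul_def, Rat.cast_intCast]]
        push_cast
        simp only [hx', hxL]
      have h0 : ∑ i, ((q i : ℤ) : ℚ) • ((N.mkQ ∘ x ∘ a) ∘ e.symm) i = 0 := by
        have h1 : N.mkQ (∑ i, ((q i : ℚ)) • x (a (e.symm i))) = 0 :=
          (Submodule.Quotient.mk_eq_zero N).mpr hNmem
        rw [map_sum] at h1
        simpa only [map_smul, Function.comp_apply] using h1
      have hli' : LinearIndependent ℚ ((N.mkQ ∘ x ∘ a) ∘ e.symm) := hli.comp e.symm e.symm.injective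
      have h2 := Fintype.linearIndependent_iff.mp hli' _ h0
      funext i
      exact_mod_cast h2 i
    have hrank1 : 1 ≤ (Matrix.of fun i j => D1 j (x' i)).rank := by
      rw [Matrix.rank]
      by_contra hlt
      push Not at hlt
      have hbot : LinearMap.range (Matrix.of fun i j => D1 j (x' i)).mulVecLin = ⊥ :=
        Submodule.finrank_eq_zero.1 (Nat.lt_one_iff.1 hlt)
      have hmem : (Matrix.of fun i j => D1 j (x' i)).mulVecLin (Pi.single 0 1) ∈
          LinearMap.range (Matrix.of fun i j => D1 j (x' i)).mulVecLin := LinearMap.mem_range_self _ _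
      rw [hbot, Submodule.mem_bot, Matrix.mulVecLin_apply, Matrix.mulVec_single_one] at hmem
      have h := congrFun hmem ⟨0, hn'pos⟩
      simp only [Matrix.col_apply, Matrix.of_apply, Pi.zero_apply, hD1, hDz,
        Derivation.restrictScalars_apply] at h
      exact hDx' _ h
    have hAxL' := ax_schanuel_holds L 1 n' D1 x' y' (fun i => hy0 _)
      (fun _ i => hDE (a (e.symm i))) hind
    letI algCD : Algebra CD L := Algebra.ofSubsemiring CD.toSubsemiring
    have h1 : ((n' + 1 : ℕ) : Cardinal) ≤ Algebra.trdeg CD L := by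
      have h2 : ((n' + 1 : ℕ) : Cardinal) ≤ ((n' + (Matrix.of fun i j => D1 j (x' i)).rank : ℕ) : Cardinal) := by
        exact_mod_cast (by omega : n' + 1 ≤ n' + (Matrix.of fun i j => D1 j (x' i)).rank)
      exact (h2.trans hAxL').trans (trdeg_le_of_injective (Subalgebra.val _) Subtype.val_injective)
    -- an integral basis of `V` and the tuple `z̄ = (w_k · x̄)_k`
    haveI : Module.Free ℚ ↥V := Module.Free.of_divisionRing ℚ ↥V
    haveI : Module.Finite ℚ ↥V := Module.IsNoetherian.finite ℚ ↥V
    let bV := Module.finBasis ℚ V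
    have hint : ∀ k : Fin m, ∃ d : ℕ, d ≠ 0 ∧ ∃ w : Fin n → ℤ,
        ∀ i, (d : ℚ) * ((bV k : V) : Fin n → ℚ) i = w i := fun k => exists_nat_mul_eq_intCast _
    choose d hd w hw using hint
    have huV : ∀ k, (fun i => (w k i : ℚ)) ∈ V := fun k => by
      have : (fun i => (w k i : ℚ)) = (d k : ℚ) • ((bV k : V) : Fin n → ℚ) := by
        funext i; rw [Pi.smul_apply, smul_eq_mul, hw]
      rw [this]
      exact V.smul_mem _ (bV k).2
    have hli_u : LinearIndependent ℚ (fun k => fun i => (w k i : ℚ)) := by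
      have hb : LinearIndependent ℚ (fun k => ((bV k : V) : Fin n → ℚ)) :=
        bV.linearIndependent.map' V.subtype (Submodule.ker_subtype V)
      have hb2 := hb.units_smul fun k => Units.mk0 (d k : ℚ) (Nat.cast_ne_zero.mpr (hd k))
      convert hb2 using 1
      funext k i
      change (w k i : ℚ) = ((Units.mk0 (d k : ℚ) (Nat.cast_ne_zero.mpr (hd k))) •
        ((bV k : V) : Fin n → ℚ)) i
      rw [Units.smul_def, Units.val_mk0, Pi.smul_apply, smul_eq_mul, hw]
    set z : Fin m → ℂ := fun k => ∑ i, (w k i : ℂ) * x i with hz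
    -- `z̄` is ℚ-linearly independent (`x̄` is, and the rows `w_k` are)
    have hzli : LinearIndependent ℚ z := by
      rw [Fintype.linearIndependent_iff]
      intro c hc k
      have hsum : (∑ k, c k • z k) = ∑ i, (∑ k, c k * (w k i : ℚ)) • x i := by
        simp only [hz, Rat.smul_def, Finset.mul_sum]
        rw [Finset.sum_comm]
        refine Finset.sum_congr rfl fun i _ => ?_
        push_cast
        rw [Finset.sum_mul]
        refine Finset.sum_congr rfl fun k _ => ?_
        ring
      rw [hsum] at hc
      have hcoef := (Fintype.linearIndependent_iff.1 hxli) _ hc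
      have hvec : (∑ k, c k • fun i => (w k i : ℚ)) = 0 := by
        funext i
        simp only [Finset.sum_apply, Pi.smul_apply, smul_eq_mul, Pi.zero_apply]
        exact hcoef i
      exact (Fintype.linearIndependent_iff.1 hli_u) c hvec k
    -- `SchanuelRank m` on `z̄`
    have hSR : (m : Cardinal) ≤ Algebra.trdeg ℚ
        ↥(IntermediateField.adjoin ℚ (Set.range z ∪ Set.range (cexp ∘ z))) := hrank m hmn z hzli
    -- `z_k ∈ L` and `e^{z_k} ∈ L` are killed by `D`
    set zLk : Fin m → L := fun k => ∑ i, (w k i : L) * xL i with hzLk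
    have hzcoe : ∀ k, ((zLk k : L) : ℂ) = z k := fun k => by
      simp only [hzLk, hz, hxL]
      push_cast
      rfl
    have hDz0 : ∀ k, D (zLk k) = 0 := fun k => by
      obtain ⟨l, hl0, hl⟩ := (hmemN _).mp (Submodule.mem_comap.mp (huV k))
      have hTz : T (fun i => (w k i : ℚ)) = z k := by
        rw [hTapply, hz]
        exact Finset.sum_congr rfl fun i _ => by rw [Rat.smul_def, Rat.cast_intCast]
      have hl' : l = zLk k := Subtype.ext (by rw [hl, hTz, hzcoe])
      rw [← hl']
      exact hl0
    set ezLk : Fin m → L := fun k => ∏ i, yL i ^ w k i with hezLk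
    have hezcoe : ∀ k, ((ezLk k : L) : ℂ) = cexp (z k) := fun k => by
      rw [hz]
      dsimp only
      rw [Complex.exp_sum]
      simp only [hezLk, hyL]
      push_cast
      refine Finset.prod_congr rfl fun i _ => ?_
      rw [Complex.exp_int_mul]
      exact map_zpow₀ (algebraMap (↥L) ℂ) _ _
    have hDez0 : ∀ k, D (ezLk k) = 0 := fun k => by
      simp only [hezLk]
      rw [derivation_prod_zpow_of_exp D xL yL hy0 hDE (w k)]
      have : D (∑ i, (w k i : L) * xL i) = 0 := hDz0 k
      rw [this, mul_zero]
    set Sz : Set ℂ := Set.range z ∪ Set.range (cexp ∘ z) with hSz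
    set Nz : IntermediateField ℚ ℂ := IntermediateField.adjoin ℚ Sz with hNz
    have hle : Nz ≤ L := by
      rw [hNz, IntermediateField.adjoin_le_iff]
      rintro t (⟨k, rfl⟩ | ⟨k, rfl⟩)
      · rw [← hzcoe]; exact (zLk k).2
      · simp only [Function.comp_apply]; rw [← hezcoe]; exact (ezLk k).2
    have hιE : ∀ (t : ℂ) (ht : t ∈ Nz), (⟨t, hle ht⟩ : L) ∈ CD := by
      intro t ht
      rw [hmemCD]
      induction ht using IntermediateField.adjoin_induction with
      | mem t ht =>
        rcases ht with ⟨k, rfl⟩ | ⟨k, rfl⟩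
        · have h' : (⟨z k, hle (IntermediateField.subset_adjoin ℚ Sz (Or.inl ⟨k, rfl⟩))⟩ : L) =
              zLk k := Subtype.ext (hzcoe k).symm
          rw [h']; exact hDz0 k
        · have h' : (⟨(cexp ∘ z) k, hle (IntermediateField.subset_adjoin ℚ Sz (Or.inr ⟨k, rfl⟩))⟩ : L) =
              ezLk k := Subtype.ext (hezcoe k).symm
          rw [h']; exact hDez0 k
      | algebraMap c => exact D.map_algebraMap c
      | add s t hs ht ihs iht =>
        have h' : (⟨s + t, hle (add_mem hs ht)⟩ : L) = ⟨s, hle hs⟩ + ⟨t, hle ht⟩ := rfl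
        rw [h', map_add, ihs, iht, add_zero]
      | inv s hs ihs =>
        have h' : (⟨s⁻¹, hle (inv_mem hs)⟩ : L) = (⟨s, hle hs⟩)⁻¹ := rfl
        rw [h', Derivation.leibniz_inv, ihs, smul_zero]
      | mul s t hs ht ihs iht =>
        have h' : (⟨s * t, hle (mul_mem hs ht)⟩ : L) = ⟨s, hle hs⟩ * ⟨t, hle ht⟩ := rfl
        rw [h', Derivation.leibniz, ihs, iht, smul_zero, smul_zero, add_zero]
    -- assembling: `n + 1 = m + (n' + 1) ≤ trdeg_ℚ Nz + trdeg_CD L ≤ trdeg_ℚ L < n`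
    have htower := trdeg_add_le_of_le_subring L Nz hle CD hFCD hιE
    have hfinal : ((n + 1 : ℕ) : Cardinal) ≤ Algebra.trdeg ℚ L :=
      calc ((n + 1 : ℕ) : Cardinal) = (m : Cardinal) + ((n' + 1 : ℕ) : Cardinal) := by
            rw [← hnm]; push_cast; ring
        _ ≤ Algebra.trdeg ℚ Nz + Algebra.trdeg CD L := add_le_add hSR h1
        _ ≤ Algebra.trdeg ℚ L := htower
    have hlt : ((n + 1 : ℕ) : Cardinal) < (n : Cardinal) := lt_of_le_of_lt hfinal htr
    have : n + 1 < n := by exact_mod_cast hlt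
    omega

/-! ### 3. The catalogue declaration and its discharge -/

/-- **Barrier (catalogue declaration): at a FIRST FAILURE of the Schanuel property of `ℂ_exp`,
every finite family of derivations of `ℂ` that is exponential on the tuple is blind to the
tuple.** For every `n`, every `ℚ`-linearly independent `x ∈ ℂⁿ` with `trdeg_ℚ ℚ(x, eˣ) < n` such
that `SchanuelRank r` holds for all `r < n` (a first failure), and every finite family `D₁, …, D_m` of
derivations of `ℂ` with `Dⱼ(e^{xᵢ}) = e^{xᵢ} · Dⱼ(xᵢ)` for all `i, j` — the hypothesis of Ax's
Theorem 3 / of the tree's `ax_schanuel`, E-derivations or not — one has `Dⱼ(xᵢ) = 0` for all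
`i, j`: the tuple lies in the constants, Ax's hypothesis "`ℚ`-linearly independent modulo `C`"
fails (`not_isQLinearIndependentMod_of_firstFailure`) and Ax's rank term is `0`
(`firstFailure_rank_eq_zero`). PROVED: `axLocalDerivationsBlind_holds`.

BARRIER (D-0021).
- technique_class: ax-schanuel differential-algebra exponential-derivations tuple-local-derivations minimal-counterexample first-failure proof-by-contradiction khovanskii-point; explicitly: any derivation of `Schanuel` (or of `e ⊥ π`, `e ⊥ e^e`, `log 2 ⊥ 2^{√2}`, `π ⊥ log 2` via a minimal counterexample) that applies Ax 1971 Thm. 3 [cite: Ax1971, Thm. 3] = Kirby 2010 Thm. 5.1 [cite: Kirby2010, Thm. 5.1] AT A FIRST FAILURE `x` with ANY finite family of derivations of `ℂ` satisfying `D(e^{xᵢ}) = e^{xᵢ} D(xᵢ)` on the tuple — the instance needs `IsQLinearIndependentMod D x` (or a non-zero rank term), and both are refuted here (`not_isQLinearIndependentMod_of_firstFailure`, `firstFailure_rank_eq_zero`, `not_schanuelProperty_imp_ax_hypothesis_fails`).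
- blocks: the summit `Schanuel` (`SchanuelProperty ℂ = ∀ n, SchanuelRank n`) argued by contradiction from a first failure (which exists as soon as `SchanuelProperty ℂ` fails, `exists_firstFailure_of_not_schanuelProperty`) through Ax's theorem with tuple-local derivations; B7's escape (b) "Ax's theorem with arbitrary (non-E-) derivations satisfying `D zᵢ = zᵢ D yᵢ` on the tuple only" (`AxSchanuelFunctionalNotNumerical`, `scope_caveats` (b)) at every first failure, not only at the four classical pairs (`classicalPairs_not_isQLinearIndependentMod_allDerivations`, `AxSchanuelFunctionalNotNumericalNarrow.lean`) [cite: Ax1971, Thm. 3] [cite: Kirby2010, Prop. 4.7 and Prop. 7.2]; the rank-term use of Ax at the crux `MinimalCounterexampleInAcl` of route `Summits/Schanuel/Schanuel/Theses/RigidCore.lean` (whose antecedent is exactly "first failure").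
- because: a first failure is a non-degenerate Khovanskii point of its own `ℚ`-locus (`firstFailure_exists_khovanskiiSystem`): by the Khovanskii dichotomy [cite: Kirby2010, Lemma 4.8] the alternative is a non-zero derivation of `ℚ(x, eˣ)` exponential on the tuple, and Ax's theorem with its rank term [cite: Kirby2010, Thm. 5.1] [cite: Ax1971, Thm. 3] plus minimality (`SchanuelRank m` on the constants) gives `n + 1 ≤ trdeg ℚ(x, eˣ) < n` — Kirby's "if `ā` is an essential counterexample to the Schanuel property then `ā` is contained in `ecl^F(∅)`" [cite: Kirby2010, Prop. 7.2] read pointwise; then the Jacobian argument of "`ecl^R(C) ⊆ cl^R(C)`" — "`J (∂a₁, …, ∂aₙ)ᵀ = 0` … the determinant `|J| ≠ 0` … hence `∂aᵢ = 0`" [cite: Kirby2010, Prop. 4.7] — uses of `∂` only the chain rule and the `n` relations `∂(e^{aᵢ}) = e^{aᵢ}∂aᵢ` (`derivation_apply_eq_zero_of_khovanskiiSystem`), so it applies to every derivation exponential on the tuple.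
- evasions_known: published — numerical Schanuel statements from Ax's theorem at exponentially TRANSCENDENTAL (generic) parameters, "td(exp(x̄), exp(λx̄)/λ) ≥ n" for `λ ∉ ecl ∅` (B7 fact `baysKirbyWilkie2010_thm_1_2`) [cite: BaysKirbyWilkie2010, Thm. 1.2], and Schanuel-type statements for raising to a suitably GENERIC power obtained from Ax–Schanuel [cite: Pila2022, p. 96] — such parameters are never coordinates of a first failure (`firstFailure_mem_constantSubring` puts the whole tuple in the constants); in tree — derivations NOT exponential on the whole tuple, or Ax's theorem applied at OTHER tuples (sub-tuples, extensions `(x, w)`, locus mates, positive-dimensional families through `x`), where the isolated non-degenerate Khovanskii point `x` (`firstFailure_exists_khovanskiiSystem`) leaves an unlikely-intersection FINITENESS question rather than a functional-transcendence one (route `Summits/Schanuel/Schanuel/Theses/RigidCore.lean`, crux `MinimalCounterexampleInAcl`) [folklore]; non-derivation input (archimedean / analytic structure of `ℂ_exp`, arithmetic of specific numbers), as in B7's `scope_caveats` (a), (c) [cite: Kirby2010, §1].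
- scope_caveats: the sources print Prop. 4.7 for E-derivations of a partial E-domain and Prop. 7.2 for essential counterexamples [cite: Kirby2010, Prop. 4.7 and Prop. 7.2]; the tuple-local form for arbitrary derivations and the "first failure" form (least failing rank: `trdeg < n`, `SchanuelRank r` for all `r < n`) are this file's PROVED renderings, not printed statements; what is refuted is exactly the instantiation of Ax's hypothesis `IsQLinearIndependentMod D x` / a non-zero rank term AT the first-failure tuple `x` itself, for derivations of `ℂ` exponential on that tuple (families of any size, one derivation at a time via `m = 1`) — NOT uses of Ax's theorem at other tuples (sub-tuples need not be first failures; extended tuples `(x, w)`; locus mates), nor in other differential fields (power series, function fields: Ax–Schanuel proper [cite: Ax1971, Thm. 3]); first failures are not known to exist: their existence is equivalent to the failure of `SchanuelProperty ℂ` (`exists_firstFailure_of_not_schanuelProperty`; conversely `SchanuelRank n` excludes them at rank `n`) [folklore].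
- status: established [cite: Kirby2010, Prop. 4.7, Lemma 4.8, Thm. 5.1, Prop. 7.2] [cite: Ax1971, Thm. 3] — PROVED here (`axLocalDerivationsBlind_holds`). -/
def AxLocalDerivationsBlind : Prop :=
  ∀ (n : ℕ) (x : Fin n → ℂ), LinearIndependent ℚ x →
    Algebra.trdeg ℚ ↥(IntermediateField.adjoin ℚ (Set.range x ∪ Set.range (cexp ∘ x))) <
        (n : Cardinal) →
      (∀ r < n, Literature.NumberTheory.Transcendental.SchanuelRank r) →
        ∀ (m : ℕ) (D : Fin m → Derivation ℤ ℂ ℂ),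
          (∀ j i, D j (cexp (x i)) = cexp (x i) * D j (x i)) → ∀ j i, D j (x i) = 0

/-- **The barrier HOLDS** (PROVED, sorry-free): a first failure is a non-degenerate Khovanskii
point of its own `ℚ`-locus (`firstFailure_exists_khovanskiiSystem`: Khovanskii dichotomy + Ax's
theorem with its rank term + minimality), and at a non-degenerate Khovanskii point every derivation
exponential on the tuple kills the tuple (`derivation_apply_eq_zero_of_khovanskiiSystem`, Kirby's
Prop. 4.7 Jacobian argument). [cite: Kirby2010, Prop. 4.7, Lemma 4.8 and Prop. 7.2]
[cite: Ax1971, Thm. 3] -/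
theorem axLocalDerivationsBlind_holds : AxLocalDerivationsBlind := by
  intro n x hxli htr hrank m D hexp j
  obtain ⟨g, hg0, hdet⟩ := firstFailure_exists_khovanskiiSystem hxli htr hrank
  exact derivation_apply_eq_zero_of_khovanskiiSystem x (cexp ∘ x) g hg0 hdet (D j)
    (fun i => hexp j i)

/-! ### 4. Corollaries: Ax's Theorem 3 has no instance at a first failure -/

section Corollaries

variable {n : ℕ} {x : Fin n → ℂ}

/-- A first failure has positive rank (`trdeg < 0` is impossible); the Summits-side
`firstFailure_two_le` even gives `n ≥ 2`. [folklore] -/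
theorem firstFailure_pos
    (htr : Algebra.trdeg ℚ ↥(IntermediateField.adjoin ℚ (range x ∪ range (cexp ∘ x))) < (n : Cardinal)) :
    0 < n := by
  rcases Nat.eq_zero_or_pos n with rfl | hn
  · exact absurd htr (not_lt.2 (by simp))
  · exact hn

/-- At a first failure the whole tuple `x` AND its exponentials lie in the field of constants
`C = ⋂ ker Dⱼ` of every finite family of derivations of `ℂ` exponential on the tuple.
[cite: Kirby2010, Prop. 4.7 and Prop. 7.2] [cite: Ax1971, Thm. 3] -/
theorem firstFailure_mem_constantSubring (hxli : LinearIndependent ℚ x)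
    (htr : Algebra.trdeg ℚ ↥(IntermediateField.adjoin ℚ (range x ∪ range (cexp ∘ x))) < (n : Cardinal))
    (hrank : ∀ r < n, SchanuelRank r) {m : ℕ} (D : Fin m → Derivation ℤ ℂ ℂ)
    (hexp : ∀ j i, D j (cexp (x i)) = cexp (x i) * D j (x i)) (i : Fin n) :
    x i ∈ constantSubring D ∧ cexp (x i) ∈ constantSubring D := by
  have h0 : ∀ j, D j (x i) = 0 := fun j => axLocalDerivationsBlind_holds n x hxli htr hrank m D hexp j i
  refine ⟨mem_constantSubring.mpr h0, mem_constantSubring.mpr fun j => ?_⟩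
  rw [hexp j i, h0 j, mul_zero]

/-- **Ax's hypothesis fails at every first failure, for EVERY finite family of derivations of `ℂ`
exponential on the tuple**: `x` is not `ℚ`-linearly independent modulo the constants
(`IsQLinearIndependentMod`, the hypothesis of the tree's `ax_schanuel` = Ax 1971 Thm. 3), since
already `x₀ ∈ C`. B7's escape (b) is closed at first failures. [cite: Ax1971, Thm. 3]
[cite: Kirby2010, Prop. 4.7 and Prop. 7.2] -/
theorem not_isQLinearIndependentMod_of_firstFailure (hxli : LinearIndependent ℚ x)
    (htr : Algebra.trdeg ℚ ↥(IntermediateField.adjoin ℚ (range x ∪ range (cexp ∘ x))) < (n : Cardinal))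
    (hrank : ∀ r < n, SchanuelRank r) {m : ℕ} (D : Fin m → Derivation ℤ ℂ ℂ)
    (hexp : ∀ j i, D j (cexp (x i)) = cexp (x i) * D j (x i)) :
    ¬ IsQLinearIndependentMod D x :=
  not_isQLinearIndependentMod_of_mem (i₀ := ⟨0, firstFailure_pos htr⟩)
    (firstFailure_mem_constantSubring hxli htr hrank D hexp _).1

/-- **Ax's rank term vanishes at every first failure**: the matrix `(Dⱼ xᵢ)ᵢⱼ` of Ax's Theorem 3
is `0` (hence of rank `0`) for every finite family of derivations of `ℂ` exponential on the tuple.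
[cite: Ax1971, Thm. 3] [cite: Kirby2010, Thm. 5.1] -/
theorem firstFailure_rank_eq_zero (hxli : LinearIndependent ℚ x)
    (htr : Algebra.trdeg ℚ ↥(IntermediateField.adjoin ℚ (range x ∪ range (cexp ∘ x))) < (n : Cardinal))
    (hrank : ∀ r < n, SchanuelRank r) {m : ℕ} (D : Fin m → Derivation ℤ ℂ ℂ)
    (hexp : ∀ j i, D j (cexp (x i)) = cexp (x i) * D j (x i)) :
    (Matrix.of fun i j => D j (x i)) = 0 ∧ (Matrix.of fun i j => D j (x i)).rank = 0 := by
  have hM : (Matrix.of fun i j => D j (x i)) = 0 := by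
    ext i j
    exact axLocalDerivationsBlind_holds n x hxli htr hrank m D hexp j i
  exact ⟨hM, by rw [hM, Matrix.rank_zero]⟩

/-- The summit in the tree's exponential-field vocabulary is rank-wise Schanuel:
`SchanuelProperty ℂ ↔ ∀ n, SchanuelRank n` (definitional). [folklore] -/
theorem schanuelProperty_complex_iff_forall_schanuelRank :
    Literature.ModelTheory.ExponentialFields.SchanuelProperty ℂ ↔ ∀ n, SchanuelRank n :=
  Iff.rfl

/-- **Every failure of Schanuel's conjecture produces a FIRST failure** (least failing rank): some
`ℚ`-linearly independent `x ∈ ℂⁿ` with `trdeg_ℚ ℚ(x, eˣ) < n` and `SchanuelRank r` for all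
`r < n` (well-ordering of `ℕ`; a first failure is in particular an essential counterexample in
Kirby's sense, §1: "every counterexample contains an essential counterexample in its `ℚ`-linear
span"). The Summits-side `exists_firstFailure_of_not_schanuel` is the same statement for the
summit `Schanuel`. [folklore] -/
theorem exists_firstFailure_of_not_schanuelProperty
    (h : ¬ Literature.ModelTheory.ExponentialFields.SchanuelProperty ℂ) :
    ∃ (n : ℕ) (x : Fin n → ℂ), LinearIndependent ℚ x ∧
      Algebra.trdeg ℚ ↥(IntermediateField.adjoin ℚ (range x ∪ range (cexp ∘ x))) < (n : Cardinal) ∧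
      ∀ r < n, SchanuelRank r := by
  classical
  have h' : ∃ n, ¬ SchanuelRank n := by
    by_contra hall
    push Not at hall
    exact h (schanuelProperty_complex_iff_forall_schanuelRank.mpr hall)
  obtain ⟨n, hn, hmin⟩ : ∃ n, ¬ SchanuelRank n ∧ ∀ r < n, SchanuelRank r :=
    ⟨Nat.find h', Nat.find_spec h', fun r hr => by
      by_contra hr'
      exact Nat.find_min h' hr hr'⟩
  simp only [SchanuelRank, not_forall, not_le] at hn
  obtain ⟨x, hli, hlt⟩ := hn
  exact ⟨n, x, hli, hlt, hmin⟩

/-- **The technique class is empty** (PROVED): if Schanuel's conjecture fails at all, it fails at a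
`ℚ`-linearly independent tuple `x` (a first failure, `trdeg_ℚ ℚ(x, eˣ) < n`, `n ≥ 1`) at which
Ax's Theorem 3 has NO instance — for every finite family of derivations of `ℂ` exponential on the
tuple, Ax's hypothesis `IsQLinearIndependentMod D x` fails and the rank matrix `(Dⱼ xᵢ)` is `0`.
A proof of the summit by contradiction from a minimal counterexample cannot invoke Ax's theorem at
that counterexample, whatever derivations of `ℂ` it constructs. [cite: Ax1971, Thm. 3]
[cite: Kirby2010, Prop. 4.7, Thm. 5.1 and Prop. 7.2] -/
theorem not_schanuelProperty_imp_ax_hypothesis_fails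
    (h : ¬ Literature.ModelTheory.ExponentialFields.SchanuelProperty ℂ) :
    ∃ (n : ℕ) (x : Fin n → ℂ), 0 < n ∧ LinearIndependent ℚ x ∧
      Algebra.trdeg ℚ ↥(IntermediateField.adjoin ℚ (range x ∪ range (cexp ∘ x))) < (n : Cardinal) ∧
      (∀ r < n, SchanuelRank r) ∧
      ∀ (m : ℕ) (D : Fin m → Derivation ℤ ℂ ℂ),
        (∀ j i, D j (cexp (x i)) = cexp (x i) * D j (x i)) →
          ¬ IsQLinearIndependentMod D x ∧ (Matrix.of fun i j => D j (x i)) = 0 := by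
  obtain ⟨n, x, hxli, htr, hrank⟩ := exists_firstFailure_of_not_schanuelProperty h
  exact ⟨n, x, firstFailure_pos htr, hxli, htr, hrank, fun m D hexp =>
    ⟨not_isQLinearIndependentMod_of_firstFailure hxli htr hrank D hexp,
      (firstFailure_rank_eq_zero hxli htr hrank D hexp).1⟩⟩

end Corollaries

end Literature.Barriers.Schanuel

end
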